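import Mathlib
import HarnessLib

/-!
# LINE 49 «full_vertex» — the GENUS-DEPTH LEMMA (Theorem A of the pen's memo #6, F10): twisted traces under a `2`-group

Crux R″ `RankOneTwoTorsionResidualAtTwo` (stmt-BirchSwinnertonDyer-27478) of route GenusKolyvaginAtTwo, LINE 49
«torsion_cell_full_vertex_bsdidea1» (pen bsd-idea-1).  This file hosts, as kernel-checked SUPPORT algebra for the line's
research stubs F0aJ′ / F0bJ (the `C₁`-halves are fed by the lower bound (LOW)_k «`y_K ∈ 2^{k−1} E₀(K_gen) + tors`» of
memo #6), the pen's HOME-only brick `line49/engine/GenusDepth.lean` r2 (W-79: the pen may not propose) in a DEF-FREE form: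
the `χ`-twisted trace is written out as `∑ g, χ g • g • y` and «`P` is a `χ`-eigenvector» as `∀ g, g • P = χ g • P`.

Pure algebra of a finite group `G` (of order `2 ^ k` where needed) acting on an additive group `Λ` by a `DistribMulAction`,
with `ℤˣ`-valued characters `χ : G →* ℤˣ` (for `G = Gal(K_gen/K) ≅ (ℤ/2)^k` these are all the characters).  Dictionary
(memo #6 §2): `Λ = E₀(K_gen)/E₀[2]` (torsion-free), `y = y_G = Tr_{H/K_gen} y_H` the genus trace of the Heegner point,
`∑ g, χ₀ g • g • y_G = y_K`, `∑ g, χ g • g • y_G = y_χ = m_χ • g′_χ` (the twisted Heegner points of the odd twists), and an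
«`e`-decomposition» `2^e • y = ∑ᵢ Pᵢ` (`Pᵢ` a `χᵢ`-eigenvector) is the statement `2^e • y_G ∈ M′ = Σ_d E₀^{(d)}(ℚ)`.

* `sum_eq_zero_of_mul_left`, `sum_char_eq_zero`, `sum_char_mul_char_eq_zero`, `sum_char_mul_self` — orthogonality of
  `ℤˣ`-valued characters (Serre, *Linear representations*, §2.3, for real characters);
* `twistedTrace_sum_eig` — the twisted trace of a sum of eigenvectors for pairwise distinct characters is `|G| •` the
  matching eigenvector; `twistedTrace_zsmul_comm`; `smul_twistedTrace` — a twisted trace IS an eigenvector (§2.3);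
* **`twistedTrace_eq_of_decomposition`** (THEOREM A ⟸): `|G| = 2^k`, `e ≤ k`, `Λ` torsion-free, `χᵢ` pairwise distinct,
  `2^e • y = ∑ᵢ Pᵢ` with `Pᵢ` a `χᵢ`-eigenvector ⟹ `∑ g, χᵢ g • g • y = 2^(k−e) • Pᵢ` — every twisted trace is divisible by
  `2^(k−e)` INSIDE its eigenline («`2^e y_G ∈ M′ ⟹ y_χ ∈ 2^{k−e} ℤ g′_χ`»; `e = 1` is (LOW)_k);
* `twistedTrace_depth_of_exponent` (COROLLARY (S′) ⟹ (LOW)); `sum_dual_eq_zero`, `sum_twistedTrace_eq` (dual orthogonality);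
* **`decomposition_of_twistedTrace_eq`** (THEOREM A ⟹): over the full character group (`|Ĝ| = 2^k`, `Ĝ` separates `G`),
  `∑ g, χ g • g • y = 2^(k−e) • P_χ` for all `χ` ⟹ `2^e • y = ∑_χ P_χ`;
* `smul_two_smul_eq_of_cocycle_two_torsion` (the δ-remark: a cocycle with `2`-torsion values has a `G`-fixed double);
* **`two_pow_smul_mem_span_iff`** / `two_smul_mem_span_iff` / `mem_span_iff` — THE DICTIONARY: with one eigenvector `g χ`
  per character and `M′ = span ℤ (range g)`, `2^e • y ∈ M′ ↔ ∀ χ, ∃ a, ∑ h, χ h • h • y = (2^(k−e)·a) • g χ`;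
* **`two_pow_card_smul_mem_span`** (EXPONENT, memo #6 §2.3, new here): if every `χ`-eigenvector of `Λ` is an integer
  multiple of `g χ` (each eigenline is `ℤ g χ` — the dictionary's «`E₀^{(d)}(ℚ)/tors = ℤ g′_d`»), then `|Ĝ| • x ∈ M′` for EVERY
  `x ∈ Λ`: `exp(Λ/M′) ∣ 2^k`.

Everything is proved (no `sorry`, standard axioms); nothing here is a statement of the line, and NOTHING HERE PROVES R″ or
any summit — BSD is not advanced by this file alone.  Source of the mathematics: pen memo #6
`Cruxes/…` HOME `line49/engine/g36_memo6_f10_lower_bound.md` §2; brick `GenusDepth.lean` sha16 e05cd4d9eed62a86.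

## References

* [Serre1977] J.-P. Serre, *Linear Representations of Finite Groups*, GTM 42 (1977), §2.3 (orthogonality of characters).
* [TianYuanZhang2017] Y. Tian, X. Yuan, S.-W. Zhang, *Genus periods, genus points and congruent number problem*, Asian J.
  Math. 21 (2017) — genus (twisted) traces of Heegner points.
* [ShuZhai2021] J. Shu, S. Zhai, *Generalized Birch lemma and the 2-part of the Birch and Swinnerton-Dyer conjecture for
  certain elliptic curves*, arXiv:2102.11808, §3 (the induction on twisted Heegner points `y_M`).
-/

namespace Summit.BirchSwinnertonDyer.BirchSwinnertonDyer.Theorems.GenusKolyvaginAtTwo.FullVertex.GenusDepth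

open BigOperators Finset

section Characters

variable {G : Type*} [Group G] [Fintype G]

/-- The reindexing trick: a function with `f (g₀ * g) = f g₀ * f g` and `f g₀ = -1` sums to zero over `G`.
[cite: Serre1977, §2.3] -/
theorem sum_eq_zero_of_mul_left (f : G → ℤ) (g₀ : G) (hmul : ∀ g, f (g₀ * g) = f g₀ * f g)
    (hneg : f g₀ = -1) : ∑ g, f g = 0 := by
  have h1 : ∑ g, f (g₀ * g) = ∑ g, f g := by
    simpa using (Equiv.sum_comp (Equiv.mulLeft g₀) f)
  have h2 : ∑ g, f (g₀ * g) = f g₀ * ∑ g, f g := by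
    rw [Finset.mul_sum]; exact Finset.sum_congr rfl fun g _ => hmul g
  rw [hneg] at h2
  have : ∑ g, f g = -1 * ∑ g, f g := h1.symm.trans h2
  linarith

omit [Fintype G] in
/-- A unit of `ℤ` other than `1` is `-1` (as an integer). [cite: Serre1977, §2.3] -/
theorem units_int_val_eq_neg_one_of_ne_one {u : ℤˣ} (hu : u ≠ 1) : (u : ℤ) = -1 := by
  rcases Int.units_eq_one_or u with rfl | rfl
  · exact absurd rfl hu
  · rfl

/-- Orthogonality I: a nontrivial `ℤˣ`-valued character sums to zero. [cite: Serre1977, §2.3] -/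
theorem sum_char_eq_zero (χ : G →* ℤˣ) (hχ : χ ≠ 1) : ∑ g, ((χ g : ℤˣ) : ℤ) = 0 := by
  obtain ⟨g₀, hg₀⟩ : ∃ g, χ g ≠ 1 := by
    by_contra h
    push Not at h
    exact hχ (MonoidHom.ext fun g => by simpa using h g)
  refine sum_eq_zero_of_mul_left _ g₀ (fun g => ?_) (units_int_val_eq_neg_one_of_ne_one hg₀)
  rw [map_mul, Units.val_mul]

/-- Orthogonality II (distinct characters): `∑ g, χ g · ψ g = 0` for `χ ≠ ψ`. [cite: Serre1977, §2.3] -/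
theorem sum_char_mul_char_eq_zero (χ ψ : G →* ℤˣ) (h : χ ≠ ψ) :
    ∑ g, ((χ g : ℤˣ) : ℤ) * ((ψ g : ℤˣ) : ℤ) = 0 := by
  obtain ⟨g₀, hg₀⟩ : ∃ g, χ g ≠ ψ g := by
    by_contra hc
    push Not at hc
    exact h (MonoidHom.ext hc)
  have hneg : ((χ g₀ : ℤˣ) : ℤ) * ((ψ g₀ : ℤˣ) : ℤ) = -1 := by
    rcases Int.units_eq_one_or (χ g₀) with h1 | h1 <;>
      rcases Int.units_eq_one_or (ψ g₀) with h2 | h2 <;>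
      simp_all
  refine sum_eq_zero_of_mul_left (fun g => ((χ g : ℤˣ) : ℤ) * ((ψ g : ℤˣ) : ℤ)) g₀ (fun g => ?_) hneg
  simp only [map_mul, Units.val_mul]; ring

/-- Orthogonality II (equal characters): `∑ g, χ g ^ 2 = |G|`. [cite: Serre1977, §2.3] -/
theorem sum_char_mul_self (χ : G →* ℤˣ) :
    ∑ g, ((χ g : ℤˣ) : ℤ) * ((χ g : ℤˣ) : ℤ) = (Fintype.card G : ℤ) := by
  simp

end Characters

section Depth

variable {G : Type*} [Group G] [Fintype G]
variable {Λ : Type*} [AddCommGroup Λ] [DistribMulAction G Λ]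

/-- The twisted trace of a sum of eigenvectors for pairwise distinct characters `χⱼ`:
`∑ g, χᵢ g • g • (∑ⱼ Pⱼ) = |G| • Pᵢ`.  (Brick `tw_sum_eig`, def-free.) [cite: Serre1977, §2.3] -/
theorem twistedTrace_sum_eig {ι : Type*} [Fintype ι] [DecidableEq ι] (χ : ι → (G →* ℤˣ))
    (hχ : Function.Injective χ) (P : ι → Λ) (hP : ∀ i, ∀ g : G, g • P i = ((χ i g : ℤˣ) : ℤ) • P i) (i : ι) :
    ∑ g : G, ((χ i g : ℤˣ) : ℤ) • g • (∑ j, P j) = (Fintype.card G : ℤ) • P i := by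
  have step : ∀ g : G, ((χ i g : ℤˣ) : ℤ) • g • (∑ j, P j)
      = ∑ j, (((χ i g : ℤˣ) : ℤ) * ((χ j g : ℤˣ) : ℤ)) • P j := by
    intro g
    rw [Finset.smul_sum, Finset.smul_sum]
    refine Finset.sum_congr rfl fun j _ => ?_
    rw [hP j g, smul_smul]
  rw [Finset.sum_congr rfl fun g _ => step g, Finset.sum_comm]
  simp_rw [← Finset.sum_smul]
  rw [Finset.sum_eq_single i]
  · rw [sum_char_mul_self]
  · intro j _ hji
    rw [sum_char_mul_char_eq_zero _ _ (fun h => hji (hχ h).symm), zero_smul]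
  · intro h; exact absurd (Finset.mem_univ i) h

/-- Twisted traces commute with integer scalars: `∑ g, χ g • g • (n • y) = n • ∑ g, χ g • g • y`.
(Brick `tw_zsmul_comm`.) [cite: Serre1977, §2.3] -/
theorem twistedTrace_zsmul_comm (χ : G →* ℤˣ) (n : ℤ) (y : Λ) :
    ∑ g : G, ((χ g : ℤˣ) : ℤ) • g • (n • y) = n • ∑ g : G, ((χ g : ℤˣ) : ℤ) • g • y := by
  rw [Finset.smul_sum]
  refine Finset.sum_congr rfl fun g _ => ?_
  rw [smul_comm g n y, smul_comm ((χ g : ℤˣ) : ℤ) n]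

/-- A twisted trace IS a `χ`-eigenvector: `g₀ • ∑ g, χ g • g • y = χ g₀ • ∑ g, χ g • g • y` (memo #6 §2.3: `tw_χ(x)` is an
honest `χ`-eigenvector of `E₀(K_gen)`, fixed by `ker χ` and anti-fixed outside). [cite: Serre1977, §2.3] -/
theorem smul_twistedTrace (χ : G →* ℤˣ) (y : Λ) (g₀ : G) :
    g₀ • ∑ g : G, ((χ g : ℤˣ) : ℤ) • g • y = ((χ g₀ : ℤˣ) : ℤ) • ∑ g : G, ((χ g : ℤˣ) : ℤ) • g • y := by
  have hinv : ((χ g₀⁻¹ : ℤˣ) : ℤ) = ((χ g₀ : ℤˣ) : ℤ) := by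
    rw [map_inv, Int.units_inv_eq_self]
  -- reindex `g ↦ g₀ * g`
  have hre : ∑ g : G, ((χ (g₀⁻¹ * (g₀ * g)) : ℤˣ) : ℤ) • (g₀ * g) • y
      = ∑ g : G, ((χ (g₀⁻¹ * g) : ℤˣ) : ℤ) • g • y :=
    Equiv.sum_comp (Equiv.mulLeft g₀) (fun g => ((χ (g₀⁻¹ * g) : ℤˣ) : ℤ) • g • y)
  calc g₀ • ∑ g : G, ((χ g : ℤˣ) : ℤ) • g • y
      = ∑ g : G, ((χ g : ℤˣ) : ℤ) • (g₀ * g) • y := by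
        rw [Finset.smul_sum]
        refine Finset.sum_congr rfl fun g _ => ?_
        rw [smul_comm g₀ ((χ g : ℤˣ) : ℤ) (g • y), mul_smul]
    _ = ∑ g : G, ((χ (g₀⁻¹ * (g₀ * g)) : ℤˣ) : ℤ) • (g₀ * g) • y := by
        refine Finset.sum_congr rfl fun g _ => ?_
        rw [inv_mul_cancel_left]
    _ = ∑ g : G, ((χ (g₀⁻¹ * g) : ℤˣ) : ℤ) • g • y := hre
    _ = ((χ g₀ : ℤˣ) : ℤ) • ∑ g : G, ((χ g : ℤˣ) : ℤ) • g • y := by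
        rw [Finset.smul_sum]
        refine Finset.sum_congr rfl fun g _ => ?_
        rw [map_mul, Units.val_mul, hinv, ← smul_smul]

/-- **THEOREM A (⟸, the direction memo #6 uses).**  If `|G| = 2^k`, `e ≤ k`, `Λ` is `ℤ`-torsion-free, the characters `χᵢ` are
pairwise distinct and `2^e • y = ∑ᵢ Pᵢ` with each `Pᵢ` a `χᵢ`-eigenvector, then every twisted trace of `y` is `2^(k−e)` times
the matching eigencomponent: `∑ g, χᵢ g • g • y = 2^(k−e) • Pᵢ`.  Dictionary (`Λ = E₀(K_gen)/E₀[2]`, `y = y_G`,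
`|G| = [K_gen : K] = 2^k`): «`2^e y_G ∈ M′ ⟹ y_χ ∈ 2^(k−e) ℤ g′_χ` for every `χ`», in particular (`e = 1`)
`y_K = ∑ g, g • y_G ∈ 2^(k−1) Λ` — the (LOW)_k line.  (Brick `twist_eq_of_decomposition`.)
[cite: TianYuanZhang2017, §1] [cite: ShuZhai2021, §3] -/
theorem twistedTrace_eq_of_decomposition [NoZeroSMulDivisors ℤ Λ] {k e : ℕ} (hG : Fintype.card G = 2 ^ k)
    (he : e ≤ k) {ι : Type*} [Fintype ι] [DecidableEq ι] (χ : ι → (G →* ℤˣ))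
    (hχ : Function.Injective χ) (P : ι → Λ) (hP : ∀ i, ∀ g : G, g • P i = ((χ i g : ℤˣ) : ℤ) • P i) (y : Λ)
    (hy : ((2 : ℤ) ^ e) • y = ∑ j, P j) (i : ι) :
    ∑ g : G, ((χ i g : ℤˣ) : ℤ) • g • y = ((2 : ℤ) ^ (k - e)) • P i := by
  have h1 : ∑ g : G, ((χ i g : ℤˣ) : ℤ) • g • (((2 : ℤ) ^ e) • y)
      = ((2 : ℤ) ^ e) • ∑ g : G, ((χ i g : ℤˣ) : ℤ) • g • y := twistedTrace_zsmul_comm _ _ _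
  have h2 : ∑ g : G, ((χ i g : ℤˣ) : ℤ) • g • (((2 : ℤ) ^ e) • y) = ((2 : ℤ) ^ k) • P i := by
    rw [hy, twistedTrace_sum_eig χ hχ P hP i, hG]; push_cast; rfl
  have h3 : ((2 : ℤ) ^ e) • ∑ g : G, ((χ i g : ℤˣ) : ℤ) • g • y
      = ((2 : ℤ) ^ e) • (((2 : ℤ) ^ (k - e)) • P i) := by
    rw [← h1, h2, smul_smul, ← pow_add, Nat.add_sub_cancel' he]
  have hne : ((2 : ℤ) ^ e) ≠ 0 := pow_ne_zero _ two_ne_zero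
  exact smul_right_injective Λ hne h3

/-- **COROLLARY ((S′) ⟹ (LOW)).**  If EVERY element of `Λ` has an `e`-decomposition over the (distinct) characters `χᵢ`
(«`exp(Λ/M′) ∣ 2^e`»), then every twisted trace of every `y` is `2^(k−e)` times a `χᵢ`-eigenvector.
(Brick `twist_depth_of_exponent`.) [cite: TianYuanZhang2017, §1] -/
theorem twistedTrace_depth_of_exponent [NoZeroSMulDivisors ℤ Λ] {k e : ℕ} (hG : Fintype.card G = 2 ^ k)
    (he : e ≤ k) {ι : Type*} [Fintype ι] [DecidableEq ι] (χ : ι → (G →* ℤˣ))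
    (hχ : Function.Injective χ)
    (hΛ : ∀ x : Λ, ∃ P : ι → Λ, (∀ i, ∀ g : G, g • P i = ((χ i g : ℤˣ) : ℤ) • P i) ∧ ((2 : ℤ) ^ e) • x = ∑ j, P j)
    (y : Λ) (i : ι) :
    ∃ Q : Λ, (∀ g : G, g • Q = ((χ i g : ℤˣ) : ℤ) • Q) ∧
      ∑ g : G, ((χ i g : ℤˣ) : ℤ) • g • y = ((2 : ℤ) ^ (k - e)) • Q := by
  obtain ⟨P, hP, hy⟩ := hΛ y
  exact ⟨P i, hP i, twistedTrace_eq_of_decomposition hG he χ hχ P hP y hy i⟩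

omit [Fintype G] in
/-- Dual orthogonality: if the character group separates `G`, then `∑_χ χ g = 0` for `g ≠ 1`. [cite: Serre1977, §2.3] -/
theorem sum_dual_eq_zero [Fintype (G →* ℤˣ)] (hsep : ∀ g : G, g ≠ 1 → ∃ χ : G →* ℤˣ, χ g ≠ 1)
    {g : G} (hg : g ≠ 1) : ∑ χ : G →* ℤˣ, ((χ g : ℤˣ) : ℤ) = 0 := by
  classical
  obtain ⟨χ₀, hχ₀⟩ := hsep g hg
  have hneg : ((χ₀ g : ℤˣ) : ℤ) = -1 := units_int_val_eq_neg_one_of_ne_one hχ₀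
  have h1 : ∑ χ : G →* ℤˣ, (((χ₀ * χ) g : ℤˣ) : ℤ) = ∑ χ : G →* ℤˣ, ((χ g : ℤˣ) : ℤ) := by
    simpa using (Equiv.sum_comp (Equiv.mulLeft χ₀) (fun χ : G →* ℤˣ => ((χ g : ℤˣ) : ℤ)))
  have h2 : ∑ χ : G →* ℤˣ, (((χ₀ * χ) g : ℤˣ) : ℤ) = -1 * ∑ χ : G →* ℤˣ, ((χ g : ℤˣ) : ℤ) := by
    rw [Finset.mul_sum]
    refine Finset.sum_congr rfl fun χ _ => ?_
    rw [MonoidHom.mul_apply, Units.val_mul, hneg]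
  have := h1.symm.trans h2
  linarith

/-- `∑_χ ∑ g, χ g • g • y = |Ĝ| • y` when the character group `Ĝ` separates `G`.  (Brick `sum_tw_eq`.)
[cite: Serre1977, §2.3] -/
theorem sum_twistedTrace_eq [Fintype (G →* ℤˣ)] (hsep : ∀ g : G, g ≠ 1 → ∃ χ : G →* ℤˣ, χ g ≠ 1) (y : Λ) :
    ∑ χ : G →* ℤˣ, ∑ g : G, ((χ g : ℤˣ) : ℤ) • g • y = (Fintype.card (G →* ℤˣ) : ℤ) • y := by
  classical
  rw [Finset.sum_comm]
  simp_rw [← Finset.sum_smul]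
  rw [Finset.sum_eq_single (1 : G)]
  · simp
  · intro g _ hg
    rw [sum_dual_eq_zero hsep hg, zero_smul]
  · intro h; exact absurd (Finset.mem_univ _) h

/-- **THEOREM A (⟹).**  Over the full character group (of order `2^k`, separating `G`): if every twisted trace of `y` is
`2^(k−e)` times an element `P χ`, then `2^e • y = ∑_χ P χ` (an `e`-decomposition).  (Brick `decomposition_of_twist_eq`.)
[cite: TianYuanZhang2017, §1] -/
theorem decomposition_of_twistedTrace_eq [NoZeroSMulDivisors ℤ Λ] [Fintype (G →* ℤˣ)] {k e : ℕ}
    (hdual : Fintype.card (G →* ℤˣ) = 2 ^ k)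
    (hsep : ∀ g : G, g ≠ 1 → ∃ χ : G →* ℤˣ, χ g ≠ 1) (he : e ≤ k) (y : Λ)
    (P : (G →* ℤˣ) → Λ) (htw : ∀ χ : G →* ℤˣ, ∑ g : G, ((χ g : ℤˣ) : ℤ) • g • y = ((2 : ℤ) ^ (k - e)) • P χ) :
    ((2 : ℤ) ^ e) • y = ∑ χ, P χ := by
  have h1 : ∑ χ : G →* ℤˣ, ∑ g : G, ((χ g : ℤˣ) : ℤ) • g • y = ((2 : ℤ) ^ k) • y := by
    rw [sum_twistedTrace_eq hsep, hdual]; push_cast; rfl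
  have h2 : ∑ χ : G →* ℤˣ, ∑ g : G, ((χ g : ℤˣ) : ℤ) • g • y = ((2 : ℤ) ^ (k - e)) • ∑ χ, P χ := by
    rw [Finset.smul_sum]; exact Finset.sum_congr rfl fun χ _ => htw χ
  have h3 : ((2 : ℤ) ^ (k - e)) • (((2 : ℤ) ^ e) • y) = ((2 : ℤ) ^ (k - e)) • ∑ χ, P χ := by
    rw [← h2, h1, smul_smul, ← pow_add, Nat.sub_add_cancel he]
  exact smul_right_injective Λ (pow_ne_zero _ two_ne_zero) h3

end Depth

section Delta

variable {G : Type*} [Group G] {A : Type*} [AddCommGroup A] [DistribMulAction G A]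

/-- The δ-remark of memo #6 §2: a point whose cocycle `g ↦ g • P − P` takes `2`-torsion values has a `G`-fixed double
(`Λ^G ⊇ Λ_K ⊇ 2Λ^G` for `Λ = E₀(K_gen)/E₀[2]`, `Λ_K = E₀(K)/E₀[2]`).  (Brick, verbatim.) [cite: ShuZhai2021, §3] -/
theorem smul_two_smul_eq_of_cocycle_two_torsion (P : A)
    (h : ∀ g : G, (2 : ℤ) • (g • P - P) = 0) (g : G) : g • ((2 : ℤ) • P) = (2 : ℤ) • P := by
  have := h g
  rw [smul_sub, sub_eq_zero] at this
  rw [smul_comm, this]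

end Delta

section Dictionary

/-! ### The (LOW) dictionary (memo #6 §2.1) and the exponent bound (§2.3)

With one eigenvector `g χ` per character (the `2`-saturated odd-twist generators moved to `E₀`), the twist lattice is
`M′ = span ℤ (range g)`, and Theorem A in both directions says: `2^e • y ∈ M′` iff every twisted trace
`∑ h, χ h • h • y` is `2^(k−e)` times an integer multiple of `g χ`.  For `e = 1` and `y = y_G` this is
`(LOW)^{∀χ}_k ⟺ 2 • y_G ∈ M′`. -/

variable {G : Type*} [Group G] [Fintype G]
variable {Λ : Type*} [AddCommGroup Λ] [DistribMulAction G Λ]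

/-- **THE DICTIONARY.**  `2^e • y ∈ span ℤ (range g) ↔ ∀ χ, ∃ a : ℤ, ∑ h, χ h • h • y = (2^(k−e)·a) • g χ`, for one
`χ`-eigenvector `g χ` per character, `|G| = |Ĝ| = 2^k`, `Ĝ` separating `G`, `e ≤ k`, `Λ` torsion-free.
(Brick `two_pow_smul_mem_span_iff`.) [cite: TianYuanZhang2017, §1] -/
theorem two_pow_smul_mem_span_iff [NoZeroSMulDivisors ℤ Λ] [Fintype (G →* ℤˣ)]
    {k e : ℕ} (hG : Fintype.card G = 2 ^ k) (hdual : Fintype.card (G →* ℤˣ) = 2 ^ k)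
    (hsep : ∀ g : G, g ≠ 1 → ∃ χ : G →* ℤˣ, χ g ≠ 1) (he : e ≤ k)
    (g : (G →* ℤˣ) → Λ) (hg : ∀ χ : G →* ℤˣ, ∀ h : G, h • g χ = ((χ h : ℤˣ) : ℤ) • g χ) (y : Λ) :
    ((2 : ℤ) ^ e) • y ∈ Submodule.span ℤ (Set.range g) ↔
      ∀ χ : G →* ℤˣ, ∃ a : ℤ, ∑ h : G, ((χ h : ℤˣ) : ℤ) • h • y = (((2 : ℤ) ^ (k - e)) * a) • g χ := by
  classical
  constructor
  · intro hy χ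
    obtain ⟨c, hc⟩ := (Submodule.mem_span_range_iff_exists_fun ℤ).mp hy
    refine ⟨c χ, ?_⟩
    have h := twistedTrace_eq_of_decomposition hG he (fun ψ : G →* ℤˣ => ψ) (fun _ _ h => h)
      (fun ψ => c ψ • g ψ) (fun ψ h' => by rw [smul_comm, hg ψ h', smul_comm]) y hc.symm χ
    rw [h, smul_smul]
  · intro h
    choose a ha using h
    have h := decomposition_of_twistedTrace_eq hdual hsep he y (fun χ => a χ • g χ)
      (fun χ => by rw [ha χ, smul_smul])
    rw [h]
    exact Submodule.sum_mem _ fun χ _ => Submodule.smul_mem _ _ (Submodule.subset_span ⟨χ, rfl⟩)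

/-- `e = 1`: twice `y` lies in the twist lattice iff every twisted trace is divisible by `2^(k−1)` along its generator —
the abstract form of `(LOW)^{∀χ}_k ⟺ 2 • y_G ∈ M′`.  (Brick `two_smul_mem_span_iff`.) [cite: TianYuanZhang2017, §1] -/
theorem two_smul_mem_span_iff [NoZeroSMulDivisors ℤ Λ] [Fintype (G →* ℤˣ)]
    {k : ℕ} (hG : Fintype.card G = 2 ^ k) (hdual : Fintype.card (G →* ℤˣ) = 2 ^ k)
    (hsep : ∀ g : G, g ≠ 1 → ∃ χ : G →* ℤˣ, χ g ≠ 1) (hk : 1 ≤ k)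
    (g : (G →* ℤˣ) → Λ) (hg : ∀ χ : G →* ℤˣ, ∀ h : G, h • g χ = ((χ h : ℤˣ) : ℤ) • g χ) (y : Λ) :
    (2 : ℤ) • y ∈ Submodule.span ℤ (Set.range g) ↔
      ∀ χ : G →* ℤˣ, ∃ a : ℤ, ∑ h : G, ((χ h : ℤˣ) : ℤ) • h • y = (((2 : ℤ) ^ (k - 1)) * a) • g χ := by
  simpa using two_pow_smul_mem_span_iff hG hdual hsep hk g hg y

/-- `e = 0`: `y` itself lies in the twist lattice iff every twisted trace is divisible by `2^k` along its generator (the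
«no glue» extreme of memo #6 §3.3).  (Brick `mem_span_iff`.) [cite: TianYuanZhang2017, §1] -/
theorem mem_span_iff [NoZeroSMulDivisors ℤ Λ] [Fintype (G →* ℤˣ)]
    {k : ℕ} (hG : Fintype.card G = 2 ^ k) (hdual : Fintype.card (G →* ℤˣ) = 2 ^ k)
    (hsep : ∀ g : G, g ≠ 1 → ∃ χ : G →* ℤˣ, χ g ≠ 1)
    (g : (G →* ℤˣ) → Λ) (hg : ∀ χ : G →* ℤˣ, ∀ h : G, h • g χ = ((χ h : ℤˣ) : ℤ) • g χ) (y : Λ) :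
    y ∈ Submodule.span ℤ (Set.range g) ↔
      ∀ χ : G →* ℤˣ, ∃ a : ℤ, ∑ h : G, ((χ h : ℤˣ) : ℤ) • h • y = (((2 : ℤ) ^ k) * a) • g χ := by
  simpa using two_pow_smul_mem_span_iff hG hdual hsep (Nat.zero_le k) g hg y

/-- **EXPONENT (memo #6 §2.3).**  If each eigenline of `Λ` is `ℤ • g χ` (every `χ`-eigenvector is an integer multiple of
`g χ` — in the dictionary: `E₀^{(d)}(ℚ)/tors = ℤ g′_d`, the twists having rank one), then `|Ĝ| • x ∈ span ℤ (range g)` for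
EVERY `x ∈ Λ`: with `|Ĝ| = 2^k`, `2^k Λ ⊆ M′`, i.e. `exp(Λ/M′) ∣ 2^k`.  Proof: each twisted trace of `x` is a
`χ`-eigenvector (`smul_twistedTrace`), hence in `ℤ g χ`, and their sum over `χ` is `|Ĝ| • x` (`sum_twistedTrace_eq`).
[cite: TianYuanZhang2017, §1] -/
theorem card_dual_smul_mem_span [Fintype (G →* ℤˣ)]
    (hsep : ∀ g : G, g ≠ 1 → ∃ χ : G →* ℤˣ, χ g ≠ 1)
    (g : (G →* ℤˣ) → Λ)
    (hsat : ∀ χ : G →* ℤˣ, ∀ P : Λ, (∀ h : G, h • P = ((χ h : ℤˣ) : ℤ) • P) → ∃ a : ℤ, P = a • g χ) (x : Λ) :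
    (Fintype.card (G →* ℤˣ) : ℤ) • x ∈ Submodule.span ℤ (Set.range g) := by
  classical
  rw [← sum_twistedTrace_eq hsep x]
  refine Submodule.sum_mem _ fun χ _ => ?_
  obtain ⟨a, ha⟩ := hsat χ (∑ h : G, ((χ h : ℤˣ) : ℤ) • h • x) (smul_twistedTrace χ x)
  rw [ha]
  exact Submodule.smul_mem _ _ (Submodule.subset_span ⟨χ, rfl⟩)

/-- The exponent bound in `2`-power form: `|Ĝ| = 2^k` and rank-one eigenlines ⟹ `2^k • x ∈ M′` for every `x`.
[cite: TianYuanZhang2017, §1] -/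
theorem two_pow_card_smul_mem_span [Fintype (G →* ℤˣ)] {k : ℕ} (hdual : Fintype.card (G →* ℤˣ) = 2 ^ k)
    (hsep : ∀ g : G, g ≠ 1 → ∃ χ : G →* ℤˣ, χ g ≠ 1)
    (g : (G →* ℤˣ) → Λ)
    (hsat : ∀ χ : G →* ℤˣ, ∀ P : Λ, (∀ h : G, h • P = ((χ h : ℤˣ) : ℤ) • P) → ∃ a : ℤ, P = a • g χ) (x : Λ) :
    ((2 : ℤ) ^ k) • x ∈ Submodule.span ℤ (Set.range g) := by
  have h := card_dual_smul_mem_span hsep g hsat x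
  rw [hdual] at h
  exact_mod_cast h

end Dictionary

end Summit.BirchSwinnertonDyer.BirchSwinnertonDyer.Theorems.GenusKolyvaginAtTwo.FullVertex.GenusDepth
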